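import Literature.Geometry.Kaehler.ManifoldFormsPullback
import Literature.Geometry.Kaehler.ManifoldFormsFunSmulProofs
import HarnessLib

/-!
# The model form `p^*ω_Z + d(t² p^*α)` near the fold of an origami manifold

Seventh proofs companion of `OrigamiUnfolding.lean` (fact seat of
`Literature.Geometry.Symplectic.exists_symplecticCutPieces_of_isOrigamiForm`), the MODEL of
step (S1) (Cannas da Silva–Guillemin–Pires, *Symplectic Origami*, proof of Prop. 2.8, quoting
Cannas da Silva–Guillemin–Woodward 2000, Thm. 1: near the fold `Z` an origami form is
`p^*i^*ω + d(t² p^*α)` for the projection `p : Z × (-ε, ε) → Z`, `i^*ω` the restriction to the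
fold and `α` a connection form of the null fibration).  For a manifold `N` modelled on `ℝᵐ`,
a `2`-form `ωZ` and a `1`-form `α` on `N`, the model form on `N × ℝ`
(model `(𝓡 m).prod 𝓘(ℝ, ℝ)`, the convention of the collar files `OrigamiFoldCollar*.lean`) is
written out as

  `ωZ.pullback _ Prod.fst + mextDeriv ((fun q ↦ q.2 ^ 2) • α.pullback _ Prod.fst)`;

this file proves:

* `modelForm_apply` — **its values**:
  `ω₀_{(n,t)}((a,σ),(b,τ)) = ωZ_n(a,b) + t² dα_n(a,b) + 2t (σ α_n(b) - τ α_n(a))`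
  (Leibniz rule `mextDeriv_fun_smul_apply`, naturality `mextDeriv_pullback_apply`, and the
  differential `2t dt` of `t²` read in the product chart);
* `isSmoothForm_modelForm`, `isClosedForm_modelForm` — it is smooth, and closed when `ωZ` is;
* `modelForm_apply_zero_left/…` — on `N × {0}` it kills `(0, 1)` and restricts to `ωZ`, and
  `ω₀_{(n,t)}((0,1),(v,0)) = 2t α_n(v)` (the first-order coefficient is `2α`).

Everything here is proved; no definitions, no facts.

## References

* A. Cannas da Silva, V. Guillemin, A. R. Pires, *Symplectic Origami*, IMRN 2011 =
  arXiv:0909.4065, proof of Prop. 2.8. [CannasdasilvaGuilleminPires2010]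
* A. Cannas da Silva, V. Guillemin, C. Woodward, *On the unfolding of folded symplectic
  structures*, Math. Res. Lett. 7 (2000), Thm. 1. [CannasGuilleminWoodward2000]
-/

noncomputable section

open scoped Manifold ContDiff Topology
open Set Function Filter
open Literature.Geometry.Kaehler Literature.LinearAlgebra.Alternating

namespace Literature.Geometry.Symplectic

variable {m : ℕ} {N : Type*} [TopologicalSpace N] [ChartedSpace (EuclideanSpace ℝ (Fin m)) N]
  [IsManifold (𝓡 m) ∞ N]

/-! ### Pull-backs along the projection `N × ℝ → N` -/

omit [IsManifold (𝓡 m) ∞ N] in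
/-- `d(pr₁)(a, σ) = a` on `N × ℝ`. [folklore] -/
theorem mfderiv_fst_prod_real (x : N × ℝ) (a : EuclideanSpace ℝ (Fin m)) (σ : ℝ) :
    mfderiv ((𝓡 m).prod 𝓘(ℝ, ℝ)) (𝓡 m) (Prod.fst : N × ℝ → N) x
      (((a, σ) : EuclideanSpace ℝ (Fin m) × ℝ)) = a := by
  rw [mfderiv_fst]
  rfl

omit [IsManifold (𝓡 m) ∞ N] in
/-- Values of a pulled-back `2`-form along `pr₁`. [folklore] -/
theorem pullback_fst_apply_two (β : MForm (𝓡 m) N ℝ 2) (n : N) (t : ℝ)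
    (a b : EuclideanSpace ℝ (Fin m)) (σ τ : ℝ) :
    (β.pullback ((𝓡 m).prod 𝓘(ℝ, ℝ)) (Prod.fst : N × ℝ → N)) (n, t)
      ![((a, σ) : EuclideanSpace ℝ (Fin m) × ℝ), ((b, τ) : EuclideanSpace ℝ (Fin m) × ℝ)] =
      β n ![a, b] := by
  rw [MForm.pullback_apply]
  have hvec : (fun i : Fin 2 => mfderiv ((𝓡 m).prod 𝓘(ℝ, ℝ)) (𝓡 m) (Prod.fst : N × ℝ → N) (n, t)
      (![((a, σ) : EuclideanSpace ℝ (Fin m) × ℝ), ((b, τ) : EuclideanSpace ℝ (Fin m) × ℝ)] i)) =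
      ![a, b] := by
    funext i
    fin_cases i
    · exact mfderiv_fst_prod_real (n, t) a σ
    · exact mfderiv_fst_prod_real (n, t) b τ
  exact congrArg (β n) hvec

omit [IsManifold (𝓡 m) ∞ N] in
/-- Values of a pulled-back `1`-form along `pr₁`. [folklore] -/
theorem pullback_fst_apply_one (β : MForm (𝓡 m) N ℝ 1) (n : N) (t : ℝ)
    (a : EuclideanSpace ℝ (Fin m)) (σ : ℝ) :
    (β.pullback ((𝓡 m).prod 𝓘(ℝ, ℝ)) (Prod.fst : N × ℝ → N)) (n, t)
      ![((a, σ) : EuclideanSpace ℝ (Fin m) × ℝ)] = β n ![a] := by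
  rw [MForm.pullback_apply]
  have hvec : (fun i : Fin 1 => mfderiv ((𝓡 m).prod 𝓘(ℝ, ℝ)) (𝓡 m) (Prod.fst : N × ℝ → N) (n, t)
      (![((a, σ) : EuclideanSpace ℝ (Fin m) × ℝ)] i)) = ![a] := by
    funext i
    fin_cases i
    exact mfderiv_fst_prod_real (n, t) a σ
  exact congrArg (β n) hvec

/-- The pull-back of a smooth form along `pr₁` is smooth. [folklore] -/
theorem isSmoothForm_pullback_fst {k : ℕ} {β : MForm (𝓡 m) N ℝ k} (hβ : IsSmoothForm β) :
    IsSmoothForm (β.pullback ((𝓡 m).prod 𝓘(ℝ, ℝ)) (Prod.fst : N × ℝ → N)) :=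
  (isSmoothForm_iff_smoothAt _).2 fun _ =>
    MForm.SmoothAt.pullback (Eventually.of_forall fun _ => contMDiffAt_fst)
      ((isSmoothForm_iff_smoothAt β).1 hβ _)

/-- `d` commutes with the pull-back along `pr₁` (pointwise naturality). [folklore] -/
theorem mextDeriv_pullback_fst {k : ℕ} {β : MForm (𝓡 m) N ℝ k} (hβ : IsSmoothForm β) :
    mextDeriv (β.pullback ((𝓡 m).prod 𝓘(ℝ, ℝ)) (Prod.fst : N × ℝ → N)) =
      (mextDeriv β).pullback ((𝓡 m).prod 𝓘(ℝ, ℝ)) (Prod.fst : N × ℝ → N) :=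
  funext fun _ => mextDeriv_pullback_apply (Eventually.of_forall fun _ => contMDiffAt_fst)
    ((isSmoothForm_iff_smoothAt β).1 hβ _)

/-! ### The function `t²` on `N × ℝ` and its differential in the product chart -/

omit [IsManifold (𝓡 m) ∞ N] in
/-- `(n, t) ↦ t²` is `C^∞` on `N × ℝ`. [folklore] -/
theorem contMDiff_snd_sq :
    ContMDiff ((𝓡 m).prod 𝓘(ℝ, ℝ)) 𝓘(ℝ, ℝ) ∞ (fun q : N × ℝ => q.2 ^ 2) :=
  (contDiff_id.pow 2).comp_contMDiff contMDiff_snd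

omit [IsManifold (𝓡 m) ∞ N] in
/-- In the product chart at `x`, the inverse chart acts as the identity on the `ℝ`-factor:
`((extChartAt x).symm (q, s)).2 = s`. [folklore] -/
theorem extChartAt_prod_real_symm_snd (x : N × ℝ) (p : EuclideanSpace ℝ (Fin m) × ℝ) :
    ((extChartAt ((𝓡 m).prod 𝓘(ℝ, ℝ)) x).symm p).2 = p.2 := by
  rw [extChartAt_prod]
  rfl

omit [IsManifold (𝓡 m) ∞ N] in
/-- **The differential of `t²` read in the product chart is `2t dt`**: its value on `(a, σ)` at
the point `(n, t)` is `2 t σ`. [folklore] -/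
theorem fderivWithin_snd_sq_chart (n : N) (t : ℝ) (a : EuclideanSpace ℝ (Fin m)) (σ : ℝ) :
    fderivWithin ℝ ((fun q : N × ℝ => q.2 ^ 2) ∘ (extChartAt ((𝓡 m).prod 𝓘(ℝ, ℝ)) (n, t)).symm)
      (range ((𝓡 m).prod 𝓘(ℝ, ℝ))) (extChartAt ((𝓡 m).prod 𝓘(ℝ, ℝ)) (n, t) (n, t))
      (((a, σ) : EuclideanSpace ℝ (Fin m) × ℝ)) = 2 * t * σ := by
  have hfun : ((fun q : N × ℝ => q.2 ^ 2) ∘ (extChartAt ((𝓡 m).prod 𝓘(ℝ, ℝ)) (n, t)).symm) =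
      fun p : EuclideanSpace ℝ (Fin m) × ℝ => p.2 ^ 2 := by
    funext p
    simp only [Function.comp_apply, extChartAt_prod_real_symm_snd]
  have hpt : extChartAt ((𝓡 m).prod 𝓘(ℝ, ℝ)) (n, t) (n, t) = (extChartAt (𝓡 m) n n, t) := by
    rw [extChartAt_prod]
    rfl
  rw [hfun, ModelWithCorners.Boundaryless.range_eq_univ, fderivWithin_univ, hpt]
  have hd : HasFDerivAt (fun p : EuclideanSpace ℝ (Fin m) × ℝ => p.2 ^ 2)
      ((ContinuousLinearMap.smulRight (1 : ℝ →L[ℝ] ℝ)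
        ((2 : ℕ) * ((extChartAt (𝓡 m) n n, t) : EuclideanSpace ℝ (Fin m) × ℝ).2 ^ (2 - 1))).comp
        (ContinuousLinearMap.snd ℝ (EuclideanSpace ℝ (Fin m)) ℝ))
      ((extChartAt (𝓡 m) n n, t) : EuclideanSpace ℝ (Fin m) × ℝ) :=
    (hasDerivAt_pow 2 ((extChartAt (𝓡 m) n n, t) : EuclideanSpace ℝ (Fin m) × ℝ).2).hasFDerivAt.comp
      _ hasFDerivAt_snd
  rw [hd.fderiv]
  simp
  ring

/-! ### The model form -/

omit [IsManifold (𝓡 m) ∞ N] in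
/-- `removeNth` on pairs. [folklore] -/
private theorem removeNth_zero_two {X : Type*} (u w : X) :
    (0 : Fin 2).removeNth ![u, w] = ![w] := by
  funext i; fin_cases i; rfl

omit [IsManifold (𝓡 m) ∞ N] in
/-- `removeNth` on pairs. [folklore] -/
private theorem removeNth_one_two {X : Type*} (u w : X) :
    (1 : Fin 2).removeNth ![u, w] = ![u] := by
  funext i; fin_cases i; rfl

/-- `wedgeOne θ η` on a pair, for a `1`-form `η`: `θ(u) η(w) - θ(w) η(u)` (real-valued copy of
`wedgeOne_apply_two` of `GirouxContactPathFlat.lean`, kept private to keep the import closure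
small). [folklore] -/
private theorem wedgeOne_apply_pair_real {V : Type*} [NormedAddCommGroup V] [NormedSpace ℝ V]
    (θ : V →L[ℝ] ℝ) (η : V [⋀^Fin 1]→L[ℝ] ℝ) (u w : V) :
    wedgeOne θ η ![u, w] = θ u * η ![w] - θ w * η ![u] := by
  rw [wedgeOne_apply, Fin.sum_univ_two]
  simp only [Fin.val_zero, pow_zero, one_smul, Fin.val_one, pow_one, neg_smul, smul_eq_mul,
    Matrix.cons_val_zero, Matrix.cons_val_one]
  rw [show (0 : Fin 2).removeNth ![u, w] = ![w] from removeNth_zero_two u w,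
    show (1 : Fin 2).removeNth ![u, w] = ![u] from removeNth_one_two u w]
  ring

/-- **The values of the model form** `ω₀ = p^*ωZ + d(t² p^*α)` on `N × ℝ`:
`ω₀_{(n,t)}((a,σ),(b,τ)) = ωZ_n(a,b) + t² dα_n(a,b) + 2t (σ α_n(b) - τ α_n(a))`
(Leibniz rule, naturality of `d`, `d(t²) = 2t dt`).
[cite: CannasGuilleminWoodward2000, Thm. 1] -/
theorem modelForm_apply (ωZ : MForm (𝓡 m) N ℝ 2) {α : MForm (𝓡 m) N ℝ 1} (hα : IsSmoothForm α)
    (n : N) (t : ℝ) (a b : EuclideanSpace ℝ (Fin m)) (σ τ : ℝ) :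
    (ωZ.pullback ((𝓡 m).prod 𝓘(ℝ, ℝ)) (Prod.fst : N × ℝ → N) +
      mextDeriv ((fun q : N × ℝ => q.2 ^ 2) •
        α.pullback ((𝓡 m).prod 𝓘(ℝ, ℝ)) (Prod.fst : N × ℝ → N))) (n, t)
      ![((a, σ) : EuclideanSpace ℝ (Fin m) × ℝ), ((b, τ) : EuclideanSpace ℝ (Fin m) × ℝ)] =
      ωZ n ![a, b] + (t ^ 2 * mextDeriv α n ![a, b] + 2 * t * (σ * α n ![b] - τ * α n ![a])) := by
  have hP1s : IsSmoothForm (α.pullback ((𝓡 m).prod 𝓘(ℝ, ℝ)) (Prod.fst : N × ℝ → N)) :=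
    isSmoothForm_pullback_fst hα
  have hρ : MDifferentiableAt ((𝓡 m).prod 𝓘(ℝ, ℝ)) 𝓘(ℝ, ℝ) (fun q : N × ℝ => q.2 ^ 2) (n, t) :=
    (contMDiff_snd_sq (m := m) (N := N)).mdifferentiableAt (by norm_num)
  show (ωZ.pullback ((𝓡 m).prod 𝓘(ℝ, ℝ)) (Prod.fst : N × ℝ → N)) (n, t)
      ![((a, σ) : EuclideanSpace ℝ (Fin m) × ℝ), ((b, τ) : EuclideanSpace ℝ (Fin m) × ℝ)] +
    mextDeriv ((fun q : N × ℝ => q.2 ^ 2) •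
        α.pullback ((𝓡 m).prod 𝓘(ℝ, ℝ)) (Prod.fst : N × ℝ → N)) (n, t)
      ![((a, σ) : EuclideanSpace ℝ (Fin m) × ℝ), ((b, τ) : EuclideanSpace ℝ (Fin m) × ℝ)] = _
  rw [pullback_fst_apply_two, mextDeriv_fun_smul_apply hρ ((isSmoothForm_iff_smoothAt _).1 hP1s _),
    mextDeriv_pullback_fst hα, pullback_fst_apply_two]
  congr 1
  have hw := wedgeOne_apply_pair_real
    (fderivWithin ℝ ((fun q : N × ℝ => q.2 ^ 2) ∘ (extChartAt ((𝓡 m).prod 𝓘(ℝ, ℝ)) (n, t)).symm)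
      (range ((𝓡 m).prod 𝓘(ℝ, ℝ))) (extChartAt ((𝓡 m).prod 𝓘(ℝ, ℝ)) (n, t) (n, t)))
    ((α.pullback ((𝓡 m).prod 𝓘(ℝ, ℝ)) (Prod.fst : N × ℝ → N)) (n, t))
    ((a, σ) : EuclideanSpace ℝ (Fin m) × ℝ) ((b, τ) : EuclideanSpace ℝ (Fin m) × ℝ)
  rw [fderivWithin_snd_sq_chart, fderivWithin_snd_sq_chart] at hw
  have hw' := hw.trans (congrArg₂ (fun x y : ℝ => 2 * t * σ * x - 2 * t * τ * y)
    (pullback_fst_apply_one α n t b τ) (pullback_fst_apply_one α n t a σ))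
  have hs : ((n, t) : N × ℝ).2 ^ 2 • mextDeriv α n ![a, b] = t ^ 2 * mextDeriv α n ![a, b] := rfl
  exact (congrArg₂ (· + ·) hs hw').trans (by ring)


/-- **The model form is smooth** (for smooth `ωZ`, `α`). [folklore] -/
theorem isSmoothForm_modelForm {ωZ : MForm (𝓡 m) N ℝ 2} (hωZ : IsSmoothForm ωZ)
    {α : MForm (𝓡 m) N ℝ 1} (hα : IsSmoothForm α) :
    IsSmoothForm (ωZ.pullback ((𝓡 m).prod 𝓘(ℝ, ℝ)) (Prod.fst : N × ℝ → N) +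
      mextDeriv ((fun q : N × ℝ => q.2 ^ 2) •
        α.pullback ((𝓡 m).prod 𝓘(ℝ, ℝ)) (Prod.fst : N × ℝ → N))) :=
  (isSmoothForm_pullback_fst hωZ).add (isSmoothForm_mextDeriv (inChart_mextDeriv_holds _ _ _)
    (IsSmoothForm.fun_smul' (contMDiff_snd_sq (m := m) (N := N)) (isSmoothForm_pullback_fst hα)))

/-- **The model form is closed** when `ωZ` is closed (`d p^* = p^* d`, `dd = 0`).
[cite: CannasGuilleminWoodward2000, Thm. 1] -/
theorem isClosedForm_modelForm {ωZ : MForm (𝓡 m) N ℝ 2} (hωZ : IsSmoothForm ωZ)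
    (hωZc : IsClosedForm ωZ) {α : MForm (𝓡 m) N ℝ 1} (hα : IsSmoothForm α) :
    IsClosedForm (ωZ.pullback ((𝓡 m).prod 𝓘(ℝ, ℝ)) (Prod.fst : N × ℝ → N) +
      mextDeriv ((fun q : N × ℝ => q.2 ^ 2) •
        α.pullback ((𝓡 m).prod 𝓘(ℝ, ℝ)) (Prod.fst : N × ℝ → N))) := by
  have hsm : IsSmoothForm ((fun q : N × ℝ => q.2 ^ 2) •
      α.pullback ((𝓡 m).prod 𝓘(ℝ, ℝ)) (Prod.fst : N × ℝ → N)) :=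
    IsSmoothForm.fun_smul' (contMDiff_snd_sq (m := m) (N := N)) (isSmoothForm_pullback_fst hα)
  unfold IsClosedForm
  rw [mextDeriv_add (isSmoothForm_pullback_fst hωZ)
      (isSmoothForm_mextDeriv (inChart_mextDeriv_holds _ _ _) hsm),
    mextDeriv_pullback_fst hωZ, mextDeriv_mextDeriv (inChart_mextDeriv_holds _ _ _) hsm, add_zero]
  have h0 : mextDeriv ωZ = 0 := hωZc
  rw [h0, MForm.pullback_zero]

/-- **On the fold `N × {0}` the model form kills `(0, 1)`.**
[cite: CannasGuilleminWoodward2000, Thm. 1] -/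
theorem modelForm_apply_zero_inr (ωZ : MForm (𝓡 m) N ℝ 2) {α : MForm (𝓡 m) N ℝ 1}
    (hα : IsSmoothForm α) (n : N) (v : EuclideanSpace ℝ (Fin m)) (τ : ℝ) :
    (ωZ.pullback ((𝓡 m).prod 𝓘(ℝ, ℝ)) (Prod.fst : N × ℝ → N) +
      mextDeriv ((fun q : N × ℝ => q.2 ^ 2) •
        α.pullback ((𝓡 m).prod 𝓘(ℝ, ℝ)) (Prod.fst : N × ℝ → N))) (n, 0)
      ![(((0 : EuclideanSpace ℝ (Fin m)), (1 : ℝ)) : EuclideanSpace ℝ (Fin m) × ℝ),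
        ((v, τ) : EuclideanSpace ℝ (Fin m) × ℝ)] = 0 := by
  rw [modelForm_apply ωZ hα]
  have h1 : ωZ n ![(0 : EuclideanSpace ℝ (Fin m)), v] = 0 := (ωZ n).map_coord_zero 0 rfl
  have h2 : mextDeriv α n ![(0 : EuclideanSpace ℝ (Fin m)), v] = 0 :=
    (mextDeriv α n).map_coord_zero 0 rfl
  rw [h1, h2]
  ring

/-- **On the fold the model form restricts to `ωZ`.** [cite: CannasGuilleminWoodward2000, Thm. 1] -/
theorem modelForm_apply_zero_inl_inl (ωZ : MForm (𝓡 m) N ℝ 2) {α : MForm (𝓡 m) N ℝ 1}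
    (hα : IsSmoothForm α) (n : N) (v v' : EuclideanSpace ℝ (Fin m)) :
    (ωZ.pullback ((𝓡 m).prod 𝓘(ℝ, ℝ)) (Prod.fst : N × ℝ → N) +
      mextDeriv ((fun q : N × ℝ => q.2 ^ 2) •
        α.pullback ((𝓡 m).prod 𝓘(ℝ, ℝ)) (Prod.fst : N × ℝ → N))) (n, 0)
      ![((v, (0 : ℝ)) : EuclideanSpace ℝ (Fin m) × ℝ),
        ((v', (0 : ℝ)) : EuclideanSpace ℝ (Fin m) × ℝ)] =
      ωZ n ![v, v'] := by
  rw [modelForm_apply ωZ hα]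
  ring

/-- **The `(∂ₜ, v)`-component of the model form is `2t α(v)`**: the first-order coefficient of
the model along the fold is `2α` (so that matching an origami form to the model to first order
means `B₁ = 2α` on the collar, cf. `OrigamiFoldFirstOrder*.lean`).
[cite: CannasGuilleminWoodward2000, Thm. 1] -/
theorem modelForm_apply_inr_inl (ωZ : MForm (𝓡 m) N ℝ 2) {α : MForm (𝓡 m) N ℝ 1}
    (hα : IsSmoothForm α) (n : N) (t : ℝ) (v : EuclideanSpace ℝ (Fin m)) :
    (ωZ.pullback ((𝓡 m).prod 𝓘(ℝ, ℝ)) (Prod.fst : N × ℝ → N) +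
      mextDeriv ((fun q : N × ℝ => q.2 ^ 2) •
        α.pullback ((𝓡 m).prod 𝓘(ℝ, ℝ)) (Prod.fst : N × ℝ → N))) (n, t)
      ![(((0 : EuclideanSpace ℝ (Fin m)), (1 : ℝ)) : EuclideanSpace ℝ (Fin m) × ℝ),
        ((v, (0 : ℝ)) : EuclideanSpace ℝ (Fin m) × ℝ)] = 2 * t * α n ![v] := by
  rw [modelForm_apply ωZ hα]
  have h1 : ωZ n ![(0 : EuclideanSpace ℝ (Fin m)), v] = 0 := (ωZ n).map_coord_zero 0 rfl
  have h2 : mextDeriv α n ![(0 : EuclideanSpace ℝ (Fin m)), v] = 0 :=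
    (mextDeriv α n).map_coord_zero 0 rfl
  rw [h1, h2]
  ring

end Literature.Geometry.Symplectic

end
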